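/-
Copyright (c) 2026 the pub-hodgecm-mathlib formalisation cell (harness21).  Prover seat hodgecm-mathlib-A-p19 (g20), topic T5 = P8
«(C♯)hol interior», node C∞ brick (P2) «frame alignment at the place of `ι`» (desk F0P2-plan (g9) 23:23Z).  KERNEL module: THEOREMS ONLY
(no definition, no named fact, no `sorry`, no instance, no notation).
-/
import Literature.NumberTheory.Automorphic.Liu2021.ThetaLiftFromLineFrameArchSingle
import Literature.NumberTheory.Automorphic.UnitaryGroupHolCotFormsArchCentre
import HarnessLib

/-!
# Frame alignment at the place of `ι`: the one-place element `(u at w(ι), 1)` of `U(diag dV)(𝔸)` is, through `ιA⁻¹`, the CM section of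
# `T⁻¹ · ι(g) · u^{(twist)} · ι(g)⁻¹ · T ∈ U(2,1)` times an element of the compact factor ([BorelJacquet1979, §4.1])

Topic `NumberTheory/Automorphic/Liu2021`; namespace `Literature.NumberTheory.Automorphic.Liu2021`.  KERNEL: theorems only.  Cell hodgecm-mathlib
FLOOR 0, programme P2, topic T5 = P8 «(C♯)hol interior», node **C∞** ([Liu2021, Lem. D.2 (2)] at the place of `ι`), brick (P2) of the road
«K-type of `(1,0)`-forms» (★ FILE 1 `ThetaLiftFromLineEquivariantFunctional`, ★ (W1) `DoubledWeilRepresentationArchPlacePhaseBlock`).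

The theta side of node C∞ acts through the one-place elements `adelicSingle w(ι) u`, `u ∈ U(σ_{w(ι)} diag dV)(ℂ)`, of the DIAGONAL frame (where Folland's
section is explicit); the `P` side knows the `K_∞`-type of the cotangent classes along the CM SECTION `cmArchSection : U(2,1) →* U(H)(𝔸)` of the frame
`(ι, H, T)` (★ FILE 1 §3).  This file aligns the two:

* §1 `exists_mem_cmCompactFactor_archToAdelic_eq_cmArchSection_mul` — EVERY archimedean element `a ∈ U(H)(L⁺ ⊗ ℝ)` splits as
  `(a, 1_f) = cmArchSection (π_ι a) · k` with `k ∈ K_c = cmCompactFactor` (`π_ι = archProjU21EmbCM`; ★ `archProjU21EmbCM_archPart_archSectionU21CM`; the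
  B4 pattern ★ `archToAdelic_cmArchCenter_eq_cmArchSection_mul`, which is the case `a = y · 1₃`);
* §2 `coe_map_evalC_toMixed_toAdeleGL` — the `w`-component of the diagonally embedded rational matrix `g_𝔸` is `σ_w(g)` (Mathlib `extensionEmbedding_coe`);
* §3 `coe_archAt_eq_of_cmAdelicFrameTransport_eq_adelicSingle` — if `ιA (a, 1_f) = adelicSingle w₀ u` (★ `exists_arch_cmAdelicFrameTransport_archToAdelic_eq_adelicSingle`)
  then `a_{w₀} = σ_{w₀}(g) · u · σ_{w₀}(g)⁻¹` (`ιA k = g_𝔸⁻¹ k g_𝔸`, ★ `coe_cmAdelicFrameTransport`);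
* §4 **`exists_cmArchSection_mul_of_adelicSingle_placeOf`** — at THE place `w(ι)`: for every `u ∈ U(σ_{w(ι)} diag dV)(ℂ)` there are `U ∈ U(2,1)` and
  `k ∈ K_c` with `ιA (cmArchSection U · k) = adelicSingle w(ι) u` and `U = T⁻¹ · ι(g) · u^{tw} · ι(g)⁻¹ · T` as invertible matrices, where
  `u^{tw} = GL₃(embTwist ι) u` is `u` or its entrywise conjugate according as Mathlib's embedding of the place of `ι` is `ι` or `conj ∘ ι`
  (★ `coe_archAtEmb_eq_map_embTwist`, ★ `embTwist_embedding_apply`: `embTwist ∘ σ_{w(ι)} = ι`) — the ONE point where this twist enters node C∞.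
  With ★ FILE 1 §1 this gives `pr_P [Θ̃_{ω((u at w(ι)),1)Ψ}] = R(cmArchSection U) (R(k) pr_P [Θ̃_Ψ])`, and `R(k)` fixes `P` (★ `rightRegular_eq_self_of_mem_cmCompactFactor`).

HONEST SCOPE.  Pure bookkeeping of the tree's frames; nothing of [Liu2021] is asserted.  HC_CM is proved only modulo the printed citations until rung 0
closes; this file books nothing and discharges nothing booked.

## References
* [BorelJacquet1979] A. Borel, H. Jacquet, PSPM 33.1 (1979), §4.1 (`G(𝔸) = G_∞ × G(𝔸_f)`, `G_∞ = ∏_v G(F_v)`).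
* [PlatonovRapinchuk1994] V. Platonov, A. Rapinchuk, *Algebraic Groups and Number Theory* (1994), §2.3 (unitary groups of hermitian forms, frames).
* [Liu2021] Y. Liu, Camb. J. Math. 9 (2021), proof of Prop. 4.13 Case 1 (l. 2137–2141); App. D Lem. D.2 (2) — the consumer.
-/

set_option autoImplicit false

noncomputable section

open NumberField NumberField.InfinitePlace MeasureTheory IsDedekindDomain MulAction
open scoped Matrix ComplexOrder Classical

namespace Literature.NumberTheory.Automorphic.Liu2021

open Literature.NumberTheory.Automorphic Literature.NumberTheory.Automorphic.UnitaryGroup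
open Literature.NumberTheory.Automorphic.UnitaryGroup.CotangentForms
open Literature.AlgebraicGeometry.ShimuraVarieties Literature.Geometry.ComplexHyperbolic Literature.Geometry.ComplexHyperbolic.BallModel

/-! ## §1 Every archimedean element splits along the CM section and the compact factor -/

section Split

variable (L : Type) [Field L] [NumberField L] [IsCMField L] (ι : L →+* ℂ) (H : Matrix (Fin 3) (Fin 3) L) (T : GL (Fin 3) ℂ)
  (hT : (T : Matrix (Fin 3) (Fin 3) ℂ)ᴴ * H.map ι * (T : Matrix (Fin 3) (Fin 3) ℂ) = BallModel.J)

/-- **`(a, 1_f) = cmArchSection (π_ι a) · k`, `k ∈ K_c`**, for every `a ∈ U(H)(L⁺ ⊗ ℝ)`: the quotient `k = cmArchSection(π_ι a)⁻¹ · (a, 1_f)` has trivial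
`ι`-projection (★ `archProjU21EmbCM_archPart_archSectionU21CM`), so lies in `cmCompactFactor = (ker π_ι).map archToAdelic`.
[cite: BorelJacquet1979, §4.1] -/
theorem exists_mem_cmCompactFactor_archToAdelic_eq_cmArchSection_mul
    (a : UnitaryGroup.arch (↥(maximalRealSubfield L)) L (IsCMField.complexConj L) 3 H) :
    ∃ k ∈ cmCompactFactor L ι H T hT,
      UnitaryGroup.archToAdelic (↥(maximalRealSubfield L)) L (IsCMField.complexConj L) 3 H a =
        cmArchSection L ι H T hT (archProjU21EmbCM L H ι T (formCongr_eq_of_conjTranspose L ι H T hT) a) * k := by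
  set u : U21 := archProjU21EmbCM L H ι T (formCongr_eq_of_conjTranspose L ι H T hT) a with hu
  set s := cmArchSection L ι H T hT u with hs
  set b := UnitaryGroup.archPart (↥(maximalRealSubfield L)) L (IsCMField.complexConj L) 3 H s with hb
  have hsb : s = UnitaryGroup.archToAdelic (↥(maximalRealSubfield L)) L (IsCMField.complexConj L) 3 H b :=
    cmArchSection_eq_archToAdelic_archPart L ι H T hT u
  have hproj : archProjU21EmbCM L H ι T (formCongr_eq_of_conjTranspose L ι H T hT) b = u :=
    archProjU21EmbCM_archPart_archSectionU21CM L ι H T hT u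
  refine ⟨UnitaryGroup.archToAdelic (↥(maximalRealSubfield L)) L (IsCMField.complexConj L) 3 H (b⁻¹ * a), ?_, ?_⟩
  · rw [cmCompactFactor_eq]
    refine Subgroup.mem_map_of_mem _ ?_
    rw [MonoidHom.mem_ker, map_mul, map_inv, hproj, hu, inv_mul_cancel]
  · rw [map_mul, map_inv, ← hsb, mul_inv_cancel_left]

end Split

/-! ## §2 The `w`-component of a diagonally embedded rational matrix -/

section Rational

variable (L : Type) [Field L] [NumberField L] [IsCMField L] {N : ℕ}

omit [IsCMField L] in
/-- **`(g_𝔸)_w = σ_w(g)`** entrywise: the `w`-coordinate of the archimedean part of `toAdeleGL g` is the embedding of the place applied to `g`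
(Mathlib `extensionEmbedding_coe`). [cite: BorelJacquet1979, §4.1] -/
theorem coe_map_evalC_toMixed_toAdeleGL (g : GL (Fin N) L) (w : {w : InfinitePlace L // w.IsComplex}) (i j : Fin N) :
    ((Matrix.GeneralLinearGroup.map (evalC L w) (GLn.toMixed N L (toAdeleGL L g)) : GL (Fin N) ℂ) : Matrix (Fin N) (Fin N) ℂ) i j =
      w.1.embedding ((g : Matrix (Fin N) (Fin N) L) i j) := by
  show evalC L w (((GLn.toMixed N L (toAdeleGL L g) : GL (Fin N) (mixedEmbedding.mixedSpace L)) : Matrix _ _ _) i j) = _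
  rw [evalC_apply]
  show NumberField.InfinitePlace.Completion.extensionEmbedding w.1
      ((algebraMap L (AdeleRing (𝓞 L) L) ((g : Matrix (Fin N) (Fin N) L) i j)).1 w.1) = _
  exact NumberField.InfinitePlace.Completion.extensionEmbedding_coe _ _

omit [IsCMField L] in
/-- `GL`-form of `coe_map_evalC_toMixed_toAdeleGL`: `(g_𝔸)_w = GL_N(σ_w) g`. [cite: BorelJacquet1979, §4.1] -/
theorem map_evalC_toMixed_toAdeleGL (g : GL (Fin N) L) (w : {w : InfinitePlace L // w.IsComplex}) :
    Matrix.GeneralLinearGroup.map (evalC L w) (GLn.toMixed N L (toAdeleGL L g)) = Matrix.GeneralLinearGroup.map w.1.embedding g :=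
  Units.ext (Matrix.ext fun i j => coe_map_evalC_toMixed_toAdeleGL L g w i j)

end Rational

/-! ## §3 The `w₀`-component of the `ιA`-preimage of a one-place element -/

section Preimage

variable (L : Type) [Field L] [NumberField L] [IsCMField L] {N : ℕ} (H : Matrix (Fin N) (Fin N) L) (dV : Fin N → L) (g : GL (Fin N) L)
  (hg : ((g : Matrix (Fin N) (Fin N) L).map (cmConjRingHom L))ᵀ * H * (g : Matrix (Fin N) (Fin N) L) = Matrix.diagonal dV)

/-- **If `ιA (a, 1_f) = adelicSingle w₀ u` then `a_{w₀} = σ_{w₀}(g) · u · σ_{w₀}(g)⁻¹`**: `ιA k = g_𝔸⁻¹ k g_𝔸` (★ `coe_cmAdelicFrameTransport`), read at the place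
`w₀` (★ `coe_archAt`, ★ `coe_archPart`, §2, ★ `archAt_archPart_adelicSingle`). [cite: BorelJacquet1979, §4.1] [cite: PlatonovRapinchuk1994, §2.3] -/
theorem coe_archAt_eq_of_cmAdelicFrameTransport_eq_adelicSingle (w₀ : {w : InfinitePlace L // w.IsComplex})
    (u : UnitaryGroup.archLocal L N (Matrix.diagonal dV) w₀)
    {a : UnitaryGroup.arch (↥(maximalRealSubfield L)) L (IsCMField.complexConj L) N H}
    (ha : cmAdelicFrameTransport L N H dV g hg (UnitaryGroup.archToAdelic (↥(maximalRealSubfield L)) L (IsCMField.complexConj L) N H a) =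
      UnitaryGroup.adelicSingle (↥(maximalRealSubfield L)) L (IsCMField.complexConj L) N (Matrix.diagonal dV) (IsCMField.complexConj_ne_one L)
        (complexConj_smul_infinitePlace L) w₀ u) :
    ((UnitaryGroup.archAt (↥(maximalRealSubfield L)) L (IsCMField.complexConj L) N H w₀ (complexConj_smul_infinitePlace L w₀.1)
        (IsCMField.complexConj_ne_one L) a : UnitaryGroup.archLocal L N H w₀) : GL (Fin N) ℂ) =
      Matrix.GeneralLinearGroup.map w₀.1.embedding g * (u : GL (Fin N) ℂ) * (Matrix.GeneralLinearGroup.map w₀.1.embedding g)⁻¹ := by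
  set y := UnitaryGroup.adelicSingle (↥(maximalRealSubfield L)) L (IsCMField.complexConj L) N (Matrix.diagonal dV)
    (IsCMField.complexConj_ne_one L) (complexConj_smul_infinitePlace L) w₀ u with hy
  set k := UnitaryGroup.archToAdelic (↥(maximalRealSubfield L)) L (IsCMField.complexConj L) N H a with hk
  -- matrices: `adelicVal k = g_𝔸 · adelicVal y · g_𝔸⁻¹`
  have hkmat : UnitaryGroup.adelicVal (↥(maximalRealSubfield L)) L (IsCMField.complexConj L) N H k =
      toAdeleGL L g * UnitaryGroup.adelicVal (↥(maximalRealSubfield L)) L (IsCMField.complexConj L) N (Matrix.diagonal dV) y *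
        (toAdeleGL L g)⁻¹ := by
    have h := coe_cmAdelicFrameTransport L N H dV g hg k
    rw [ha, UnitaryGroup.adelicVal_apply] at h
    rw [UnitaryGroup.adelicVal_apply, UnitaryGroup.adelicVal_apply, h]
    group
  -- the `w₀`-components
  have hyw : Matrix.GeneralLinearGroup.map (evalC L w₀)
      (GLn.toMixed N L (UnitaryGroup.adelicVal (↥(maximalRealSubfield L)) L (IsCMField.complexConj L) N (Matrix.diagonal dV) y)) =
      (u : GL (Fin N) ℂ) := by
    rw [← UnitaryGroup.coe_archPart, ← UnitaryGroup.coe_archAt (hw := complexConj_smul_infinitePlace L w₀.1)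
      (hc := IsCMField.complexConj_ne_one L), hy, UnitaryGroup.archPart_adelicSingle,
      UnitaryGroup.archAt_archSingle_self (↥(maximalRealSubfield L)) L (IsCMField.complexConj L) N (Matrix.diagonal dV)
        (IsCMField.complexConj_ne_one L) (complexConj_smul_infinitePlace L) w₀ u]
  have hak : a = UnitaryGroup.archPart (↥(maximalRealSubfield L)) L (IsCMField.complexConj L) N H k := by
    rw [hk, UnitaryGroup.archPart_archToAdelic]
  rw [hak, UnitaryGroup.coe_archAt, UnitaryGroup.coe_archPart, hkmat, map_mul, map_mul, map_inv, map_mul, map_mul, map_inv, hyw,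
    map_evalC_toMixed_toAdeleGL]

end Preimage

/-! ## §4 At the place of `ι`: the one-place element is the CM section of `T⁻¹ ι(g) u^{tw} ι(g)⁻¹ T` times an element of `K_c` -/

section PlaceOfIota

variable (L : Type) [Field L] [NumberField L] [IsCMField L] (ι : L →+* ℂ) (H : Matrix (Fin 3) (Fin 3) L) (T : GL (Fin 3) ℂ)
  (hT : (T : Matrix (Fin 3) (Fin 3) ℂ)ᴴ * H.map ι * (T : Matrix (Fin 3) (Fin 3) ℂ) = BallModel.J)
  (dV : Fin 3 → L) (g : GL (Fin 3) L)
  (hg : ((g : Matrix (Fin 3) (Fin 3) L).map (cmConjRingHom L))ᵀ * H * (g : Matrix (Fin 3) (Fin 3) L) = Matrix.diagonal dV)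

/-- **The `ι`-projection of an archimedean element with prescribed `w(ι)`-component**: if `ιA (a, 1_f) = adelicSingle w u` at a complex place `w` EQUAL to
the place of `ι`, then `π_ι a = T⁻¹ · ι(g) · u^{tw} · ι(g)⁻¹ · T` on invertible matrices, `u^{tw} = GL₃(embTwist ι) u` (★ `coe_archAtEmb_eq_map_embTwist`:
`archAtEmb ι = GL₃(embTwist ι) ∘ archAt w(ι)`; §3; ★ `embTwist_embedding_apply`: `embTwist (σ_{w(ι)} x) = ι x`). [cite: BorelJacquet1979, §4.1]
[cite: PlatonovRapinchuk1994, §2.3] -/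
theorem coe_archProjU21EmbCM_eq_of_cmAdelicFrameTransport_eq_adelicSingle (w : {w : InfinitePlace L // w.IsComplex})
    (hw : w = placeOf L ι (isComplex_mk_of_isCMField L ι)) (u : UnitaryGroup.archLocal L 3 (Matrix.diagonal dV) w)
    {a : UnitaryGroup.arch (↥(maximalRealSubfield L)) L (IsCMField.complexConj L) 3 H}
    (ha : cmAdelicFrameTransport L 3 H dV g hg (UnitaryGroup.archToAdelic (↥(maximalRealSubfield L)) L (IsCMField.complexConj L) 3 H a) =
      UnitaryGroup.adelicSingle (↥(maximalRealSubfield L)) L (IsCMField.complexConj L) 3 (Matrix.diagonal dV) (IsCMField.complexConj_ne_one L)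
        (complexConj_smul_infinitePlace L) w u) :
    ((archProjU21EmbCM L H ι T (formCongr_eq_of_conjTranspose L ι H T hT) a : U21) : GL (Fin 3) ℂ) =
      T⁻¹ * (Matrix.GeneralLinearGroup.map ι g * Matrix.GeneralLinearGroup.map (embTwist L ι) (u : GL (Fin 3) ℂ) *
        (Matrix.GeneralLinearGroup.map ι g)⁻¹) * T := by
  subst hw
  have h3 := coe_archAt_eq_of_cmAdelicFrameTransport_eq_adelicSingle L H dV g hg (placeOf L ι (isComplex_mk_of_isCMField L ι)) u ha
  have hproj : ((archProjU21EmbCM L H ι T (formCongr_eq_of_conjTranspose L ι H T hT) a : U21) : GL (Fin 3) ℂ) =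
      T⁻¹ * (archAtEmb (↥(maximalRealSubfield L)) L (IsCMField.complexConj L) 3 H ι (isComplex_mk_of_isCMField L ι)
        (complexConj_smul_infinitePlace L _) (IsCMField.complexConj_ne_one L) a : unitaryGroupOfForm (starRingEnd ℂ) (H.map ι)) * T := rfl
  rw [hproj, coe_archAtEmb_eq_map_embTwist (↥(maximalRealSubfield L)) L (IsCMField.complexConj L) 3 H (IsCMField.complexConj_ne_one L)
    (complexConj_smul_infinitePlace L) ι (isComplex_mk_of_isCMField L ι) a, h3, map_mul, map_mul, map_inv]
  have hg' : Matrix.GeneralLinearGroup.map (embTwist L ι)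
      (Matrix.GeneralLinearGroup.map (placeOf L ι (isComplex_mk_of_isCMField L ι)).1.embedding g) = Matrix.GeneralLinearGroup.map ι g :=
    Units.ext (Matrix.ext fun i j => embTwist_embedding_apply L ι _)
  rw [hg']

/-- **FRAME ALIGNMENT AT THE PLACE OF `ι`**: for every `u ∈ U(σ_w diag dV)(ℂ)` at a complex place `w` equal to the place of `ι`, there are `U ∈ U(2,1)` and
`k ∈ K_c = cmCompactFactor` such that `ιA (cmArchSection U · k) = adelicSingle w u` — the one-place element of the diagonal frame IS, through `ιA⁻¹`, the CM
section of `U` up to the compact factor — and `U = T⁻¹ · ι(g) · u^{tw} · ι(g)⁻¹ · T` on invertible matrices (★ FILE 1 §1 one-place form + §1 + the previous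
theorem).  For the torus `u = diag(s)` this is `U = C · diag(s^{tw}) · C⁻¹`, `C = T⁻¹ ι(g)`, `Cᴴ J C = diag(ι dV)` — the input of the ball-geometry brick (P3).
[cite: BorelJacquet1979, §4.1] [cite: PlatonovRapinchuk1994, §2.3] -/
theorem exists_cmArchSection_mul_eq_of_adelicSingle_placeOf (w : {w : InfinitePlace L // w.IsComplex})
    (hw : w = placeOf L ι (isComplex_mk_of_isCMField L ι)) (u : UnitaryGroup.archLocal L 3 (Matrix.diagonal dV) w) :
    ∃ (U : U21) (k : (adelicGroupData (↥(maximalRealSubfield L)) L (IsCMField.complexConj L) 3 H).Adelic),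
      k ∈ cmCompactFactor L ι H T hT ∧
      cmAdelicFrameTransport L 3 H dV g hg (cmArchSection L ι H T hT U * k) =
        UnitaryGroup.adelicSingle (↥(maximalRealSubfield L)) L (IsCMField.complexConj L) 3 (Matrix.diagonal dV) (IsCMField.complexConj_ne_one L)
          (complexConj_smul_infinitePlace L) w u ∧
      ((U : U21) : GL (Fin 3) ℂ) =
        T⁻¹ * (Matrix.GeneralLinearGroup.map ι g * Matrix.GeneralLinearGroup.map (embTwist L ι) (u : GL (Fin 3) ℂ) *
          (Matrix.GeneralLinearGroup.map ι g)⁻¹) * T := by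
  obtain ⟨a, ha, -⟩ := exists_arch_cmAdelicFrameTransport_archToAdelic_eq_adelicSingle L H dV g hg w u
  obtain ⟨k, hk, hak⟩ := exists_mem_cmCompactFactor_archToAdelic_eq_cmArchSection_mul L ι H T hT a
  refine ⟨archProjU21EmbCM L H ι T (formCongr_eq_of_conjTranspose L ι H T hT) a, k, hk, ?_,
    coe_archProjU21EmbCM_eq_of_cmAdelicFrameTransport_eq_adelicSingle L ι H T hT dV g hg w hw u ha⟩
  rw [← hak, ha]

end PlaceOfIota

end Literature.NumberTheory.Automorphic.Liu2021

end
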